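/-
Origin: expansion seat `prover-pub-hodgecm-mc-binder-2-g7-0`, handover #6 17:56Z md5 ba4747ad650e (136 l.; imports #5 + twins `Weil1964/ArchWeilDatumFactorisationTransport`, `KonnoKonno2007/JunctionHyperbolicVacuumPin` (in PKG); (J-smooth) at a real place v: `cmBlockRepAt_cmBlockSectionAt_one_hypV_tensorPi` (EXACT VALUE `ω′(s(1,a_t))(Φ₁ ⊠ Φ₂) = (hypOpW t Φ₁) ⊠ Φ₂`, no character survives) and `tendsto_cmBlockRepAt_one_hypV_tensorPi_sub_div` (Schwartz slope → `(hypOpWGen Φ₁) ⊠ Φ₂`), both modulo a small-datum hypothesis `hW₁ hc₁` of the slot exactly as BRICK-4 § 2) (`HOME/mc/pub-hodgecm-mc-binder-2/g7/pkg/HodgeCM/Model/HypCensus/SmoothBlock.lean`, md5 ba4747ad, 136 lines);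
landed by the gen-12 packager (p-g12) in gate run 36 as `HodgeCM/Model/HypCensus/SmoothBlock.lean` (verbatim).
-/
/-
Origin: speedrun cell pub-hodgecm, MODEL-CONSTRUCTION sub-cell, lineage mc-binder-2 (rows A12/A34 of the binder ledger:
`hyp12` / `hyp34`), seat prover-pub-hodgecm-mc-binder-2-g7-0 (gen 7), 2026-08-19.  Target in PKG:
`HodgeCM/Model/HypCensus/SmoothBlock.lean` (NEW additive leaf; imports this lineage's `ArchDatumBlockAt` and the K-1 twins of
`Weil1964/ArchWeilDatumFactorisationTransport` and `KonnoKonno2007/JunctionHyperbolicVacuumPin`).  KERNEL only: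
0 records / named facts / proof holes.
-/
import Summits.HodgeConjecture.HodgeCM.Model.HypCensus.ArchDatumBlockAt
import Literature.NumberTheory.Weil1964.ArchWeilDatumFactorisationTransport
import Literature.RepresentationTheory.KonnoKonno2007.JunctionHyperbolicVacuumPin

/-!
# Census kit (rows A12/A34), junction (J-smooth) at a real place: the `W`-side hyperbolic one-parameter subgroup acts on
# the CM pin's Schwartz space with an EXACT value and a Schwartz-topology derivative

PerL v5 Lemma 4.1(c) (tex ll. 488–490, 517; node N29 / seam S4) differentiates the theta kernel along the hyperbolic
one-parameter subgroup `s ↦ exp(s X₁)` of `U(W_b) ≅ U(1,1)` at each real place `b` of type `Σ₁₂`; the census field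
`ArchC.HypSmoothSide.smooth` (PKG `PerL34/ArchCHyperbolicSide.lean`) asks for exactly ONE Schwartz-topology slope limit per such
place.  This leaf proves the archimedean half of that clause for the (J-arch) datum of the CM pin, at an ARBITRARY real place
`v` of `L⁺`, in the block frame of `ArchDatumBlockAt`:

* §1 **`cmBlockRepAt_cmBlockSectionAt_one_hypV_tensorPi`** — EXACT VALUE: for every archimedean Weil datum of Konno–Konno's
  pair `U(P',Q') × U(R',S')` in the slot (the small datum, a hypothesis `hW₁` exactly as in BRICK-4 § 2 / `ArchKTypeJunction`),
  `ω′ (s (1, a_t)) (Φ₁ ⊠ Φ₂) = (hypOpW t Φ₁) ⊠ Φ₂`, where `ω′ = cmBlockRepAt`, `s = cmBlockSectionAt`,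
  `a_t = hypV r₀ s₀ t ∈ U(R',S')` the `W`-side boost and `hypOpW` the tree's explicit Schwartz operator family.  Proof: the
  tree's archimedean factorisation at product vectors (`IsArchWeilDatum.exists_circle_twist_factorisation`,
  [Folland1989, Prop. (1.43), §4.2 (4.23)]) gives `((χ ⊗ ω₁)(1, a_t) Φ₁) ⊠ Φ₂` with a continuous circle character `χ`; the
  twisted small datum is again a datum (`IsArchWeilDatum.twist`) and the tree's `W`-side boost pin
  `RealDualPair.weilDatum_apply_one_hypV_eq_hypOpW` ([Folland1989, (4.24), Prop. (4.39)]: evenness under the Weyl element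
  + continuity) kills every scalar — NO character survives on the boost.
* §2 **`tendsto_cmBlockRepAt_one_hypV_tensorPi_sub_div`** — the SLOPE: `t⁻¹ • (ω′ (s (1, a_t)) (Φ₁ ⊠ Φ₂) − Φ₁ ⊠ Φ₂) →
  (hypOpWGen Φ₁) ⊠ Φ₂` in `𝓢` as `t → 0`, `t ≠ 0` (complex scalar `(t : ℂ)⁻¹`), from the tree's
  `RealDualPair.tendsto_hypOpW_sub_div_ofReal` pushed through the continuous linear map `· ⊠ Φ₂`
  (`SchwartzMap.sumProdLeftCLM Φ₂`).
* the small-datum hypothesis is DISCHARGED in the census slot (`V_v` definite, `W_v ≅ U(1,1)`) in the sibling leaf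
  `SmoothBlockSlot` (theta-1's unconditional linearised datum `RealDualPair.isArchWeilDatum_linWeil_neg_card` + the swap
  symmetry `RealDualPair.isArchWeilDatum_swap`; separate file because its tree inputs `KonnoKonno2007/JunctionVacuumOverlapPhase`
  and cone are not yet K-1 twins).

What is NOT here (successor files of the kit): the transport of §2 back to the pin's native frame `𝓢(Fin n → L⁺ ⊗ ℝ)` and
through `Φ_∞ ↦ E(Φ_∞ ⊗ Φ_f)` into the `Θ`-initial topology of `𝒮^κ` (tree `continuous_toThetaTop_repWeilThetaDatum_tmul`,
junction (J-top)), and the dictionary `hypOpWGen ↔ hypX` on printed Fock vectors (tree `tendsto_hypOpW_binvPi_sub_div_frame`).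
Nothing here is a claim of PerL/QW8; the bracketed references are provenance of the tree theorems used.
Style lint (L-notation): no `local notation`.
-/

set_option autoImplicit false

noncomputable section

open Filter Topology
open NumberField NumberField.InfinitePlace IsDedekindDomain MeasureTheory
open scoped Matrix
open scoped Kronecker Classical TensorProduct ComplexConjugate
open Literature.NumberTheory.Automorphic Literature.NumberTheory.Automorphic.UnitaryGroup Literature.NumberTheory.Weil1964
open Literature.RepresentationTheory.HeisenbergGroup (polar Heisenberg symplecticGroup ofSymplectic)
open Literature.RepresentationTheory.KonnoKonno2007 Literature.RepresentationTheory.KonnoKonno2007.RealDualPair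
open Literature.NumberTheory.GelbartRogawski1991 Literature.NumberTheory.GelbartRogawski1991.UnitaryDualPair
open Literature.Analysis.SegalBargmann Literature.Analysis.Distribution

namespace HodgeCM.Model.HypCensus

section CMPinSmooth

variable (L : Type) [Field L] [NumberField L] [IsCMField L] {N M n : ℕ} (e : Fin N × Fin M ≃ Fin n)
variable (dV : Fin N → L) (hdV : ∀ i, IsCMField.complexConj L (dV i) = dV i) (hdV0 : ∀ i, dV i ≠ 0)
variable (dW : Fin M → L) (hdW : ∀ i, IsCMField.complexConj L (dW i) = dW i) (hdW0 : ∀ i, dW i ≠ 0)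
variable (hGR : (cmSplittingDatum L e dV hdV hdV0 dW hdW hdW0).CompatibleSplitting) (ι₁ : L →+* ℂ)
variable (v : {v : InfinitePlace ↥(maximalRealSubfield L) // v.IsReal})
variable {P' Q' R' S' : Type} [Fintype P'] [DecidableEq P'] [Fintype Q'] [DecidableEq Q'] [Fintype R'] [DecidableEq R']
  [Fintype S'] [DecidableEq S']
variable (eP : PosIdx (cmXV L dV hdV ι₁ v) ≃ P') (eQ : NegIdx (cmXV L dV hdV ι₁ v) ≃ Q')
  (eR : PosIdx (cmXW L dV dW hdW ι₁ v) ≃ R') (eS : NegIdx (cmXW L dV dW hdW ι₁ v) ≃ S')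
variable
  (h₁V : ∃ i₀ : Fin N, (∀ i, i ≠ i₀ → 0 < (ι₁ (dV i)).re) ∨ ∀ i, i ≠ i₀ → (ι₁ (dV i)).re < 0)
  (h₁W : (∀ j, 0 < (ι₁ (dW j)).re) ∨ ∀ j, (ι₁ (dW j)).re < 0)
  (hV : ∀ τ : L →+* ℂ, InfinitePlace.mk τ ≠ InfinitePlace.mk ι₁ →
    (∀ i, 0 < (τ (dV i)).re) ∨ ∀ i, (τ (dV i)).re < 0)
  (hW : ∀ τ : L →+* ℂ, InfinitePlace.mk τ ≠ InfinitePlace.mk ι₁ →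
    (∃ j₀ : Fin M, ∀ j, j ≠ j₀ → 0 < (τ (dW j)).re) ∨ ∀ j, (τ (dW j)).re < 0)

/-! ## §1 The exact value on the `W`-side boost at product vectors -/

include h₁V h₁W hV hW in
/-- **(J-smooth), exact value.**  In the block frame of the real place `v`, the (J-arch) datum of the CM pin acts on a
product vector `Φ₁ ⊠ Φ₂` along the `W`-side boost `(1, a_t)`, `a_t = hypV r₀ s₀ t ∈ U(R',S')`, by the tree's explicit operator
`hypOpW t` on the first factor and the identity on the second — for ANY small archimedean Weil datum `ω₁` of the slot (only
its existence is used).  [Folland1989, Prop. (1.43), §4.2 (4.23), (4.24), Prop. (4.39)] -/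
theorem cmBlockRepAt_cmBlockSectionAt_one_hypV_tensorPi
    {ω₁ : Representation ℂ (Ginf P' Q' R' S') (SchwartzMap (DPIdx P' Q' R' S' → ℝ) ℂ)}
    (hW₁ : IsArchWeilDatum (ι𝕎 P' Q' R' S') ω₁) (hc₁ : ∀ u, Continuous (ω₁ u)) (r₀ : R') (s₀ : S') (t : ℝ)
    (Φ₁ : SchwartzMap (DPIdx P' Q' R' S' → ℝ) ℂ)
    (Φ₂ : SchwartzMap (Fin n × {w : {w : InfinitePlace ↥(maximalRealSubfield L) // w.IsReal} // w ≠ v} → ℝ) ℂ) :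
    cmBlockRepAt L e dV hdV hdV0 dW hdW hdW0 hGR ι₁ v eP eQ eR eS
        (cmBlockSectionAt L dV hdV hdV0 dW hdW hdW0 ι₁ v eP eQ eR eS
          (((1 : UForm P' Q'), (hypV r₀ s₀ t : UForm R' S')) : Ginf P' Q' R' S'))
        (tensorPi Φ₁ Φ₂) =
      tensorPi (hypOpW P' Q' r₀ s₀ t Φ₁) Φ₂ := by
  obtain ⟨χ, hχ, hfac⟩ :=
    (isArchWeilDatum_cmBlockAt L e dV hdV hdV0 dW hdW hdW0 hGR ι₁ v eP eQ eR eS h₁V h₁W hV hW).exists_circle_twist_factorisation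
      (continuous_cmBlockRepAt L e dV hdV hdV0 dW hdW hdW0 hGR ι₁ v eP eQ eR eS) hW₁ hc₁
      (cmBlockSectionAt L dV hdV hdV0 dW hdW hdW0 ι₁ v eP eQ eR eS)
      (continuous_cmBlockSectionAt L dV hdV hdV0 dW hdW hdW0 ι₁ v eP eQ eR eS)
      (coe_cmBlockPhaseHomAt_cmBlockSectionAt L e dV hdV hdV0 dW hdW hdW0 ι₁ v eP eQ eR eS)
  rw [hfac, weilDatum_apply_one_hypV_eq_hypOpW (hW₁.twist χ hχ) r₀ s₀ t Φ₁]

/-! ## §2 The slope in the Schwartz topology of the block frame -/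

include h₁V h₁W hV hW in
/-- **(J-smooth), the slope.**  `t⁻¹ • (ω′ (s (1, a_t)) (Φ₁ ⊠ Φ₂) − Φ₁ ⊠ Φ₂) → (hypOpWGen Φ₁) ⊠ Φ₂` in `𝓢` as `t → 0`, `t ≠ 0`
(complex scalar): ONE Schwartz-topology derivative per real place, the archimedean content of `HypSmoothSide.smooth`.
[Folland1989, (4.24), Prop. (4.39)] -/
theorem tendsto_cmBlockRepAt_one_hypV_tensorPi_sub_div
    {ω₁ : Representation ℂ (Ginf P' Q' R' S') (SchwartzMap (DPIdx P' Q' R' S' → ℝ) ℂ)}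
    (hW₁ : IsArchWeilDatum (ι𝕎 P' Q' R' S') ω₁) (hc₁ : ∀ u, Continuous (ω₁ u)) (r₀ : R') (s₀ : S')
    (Φ₁ : SchwartzMap (DPIdx P' Q' R' S' → ℝ) ℂ)
    (Φ₂ : SchwartzMap (Fin n × {w : {w : InfinitePlace ↥(maximalRealSubfield L) // w.IsReal} // w ≠ v} → ℝ) ℂ) :
    Tendsto (fun t : ℝ => ((t : ℝ) : ℂ)⁻¹ •
        (cmBlockRepAt L e dV hdV hdV0 dW hdW hdW0 hGR ι₁ v eP eQ eR eS
            (cmBlockSectionAt L dV hdV hdV0 dW hdW hdW0 ι₁ v eP eQ eR eS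
              (((1 : UForm P' Q'), (hypV r₀ s₀ t : UForm R' S')) : Ginf P' Q' R' S'))
            (tensorPi Φ₁ Φ₂) - tensorPi Φ₁ Φ₂))
      (𝓝[≠] 0) (𝓝 (tensorPi (hypOpWGen P' Q' r₀ s₀ Φ₁) Φ₂)) := by
  have hT := tendsto_hypOpW_sub_div_ofReal P' Q' r₀ s₀ Φ₁
  have hL := ((SchwartzMap.sumProdLeftCLM Φ₂ :
      SchwartzMap (DPIdx P' Q' R' S' → ℝ) ℂ →L[ℂ] _).continuous.tendsto _).comp hT
  simp only [Function.comp_def, map_smul, map_sub, sumProdLeftCLM_apply_eq_tensorPi] at hL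
  refine hL.congr fun t => ?_
  rw [cmBlockRepAt_cmBlockSectionAt_one_hypV_tensorPi L e dV hdV hdV0 dW hdW hdW0 hGR ι₁ v eP eQ eR eS h₁V h₁W hV hW
    hW₁ hc₁ r₀ s₀ t Φ₁ Φ₂]

end CMPinSmooth

end HodgeCM.Model.HypCensus

end
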